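import Summits.QuantumFields.YangMills.Theorems.BalabanUVNodesN09B12ProvisosJunkUnderRzLaws
import Literature.MathematicalPhysics.QuantumFieldTheory.Balaban1983to89.Node00.Record13CarriersXPinnedHCoPH

/-!
# NODE N09 ([Balaban1987RG1] Lemma 4 (3.53) p. 280), FLAG №7 LOCATED RIDER, COMPANION — (A) THE JUNK NEEDS ONLY UNIT-FLATNESS OF THE RECIPE (`∂(U_m(M˙(1))) = 1`,
# `J_m(M˙(1)) = 0` — pure-gauge unit backgrounds included, so NO re-typing of row P8 rescues the «failing lemma»); (B) K1⁷'s ANTECEDENT CLASS IS CLOSED UNDER THE JUNK X-PIN,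
# AND THE FOUR-PIN ENGINE'S N09 SOCKET `h09` HOLDS THERE WITH ZERO LETTERS: from every `θ : Stage13HParams` with `Provisos₁₃SepCoPH ∧ (ZhUnity ∧ SlotsNondegenerate₁₃) ∧ Admissible`
# (the hypothesis of `StabilityBAtRecordR13SepCoPH`, VERBATIM) one passes — keeping all three clauses (dag-n10-d's carrier-blind transports) — to the H-level X-pinned parameter
# `θ.pinX3H λ₈ λ₁₂⁰ λ₁₃` with a ZERO-LETTER [B12] layer `λ₁₂⁰`, at which `∀ P, Lemma4Printed (θ'.toStage13Params.res.X P).F12 (θ'.toStage13Params.res.X P).c12` — the `h09` row of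
# dag-n12-d's engine `nodes₁₃CoPH_upS_fourPinW₀_pointed`, read at the parameter itself — is TRUE; so inside the crux's quantifier structure `h09` carries no content

T. Bałaban, *Renormalization group approach to lattice gauge field theories. I*, Commun. Math. Phys. **109** (1987) 249–301 [Balaban1987RG1] (= [I]); [15] = [Balaban1985Variational].
TRACK A (YM-PLAN §2b), WIDTH SEAT `pub-ymgap-dag-n09-w5` (HUMAN RULING D-0154 ∕ director-ym R399 (3a)); LOCATED RIDER to FLAG №7 of record (director-ym №209), companion of this seat's
p607123 `Summits/…/Theorems/BalabanUVNodesN09B12ProvisosJunkUnderRzLaws` (the zero-letter inhabitant of `B12Provisos Rz cB λ` survives every `Rz` with the record's row P8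
`Sect2.Residual.Laws`).  Key of record it serves: K1⁷ `StabilityBAtRecordR13SepCoPH` = stmt-QuantumFields-20542 (`--supports`, helper; count-neutral).

WHY (A).  p607123 keys the junk on row P8 `U_m(M˙(1)) = 1` exactly.  A pin of `bgI` to a gauge-fixed minimiser selector (dag-n09-w4 g2's `UkSel` = `rootGauge ∘ f₀`, dag-n09-w3 g2's
`hierGauge`) need not return `1` LITERALLY at the unit coarse field — only a pure gauge `1^{w}` — and P8 might then be re-typed.  §0 shows the junk needs only UNIT-FLATNESS:
`∂(U_m(M˙(1))) = 1` on the plaquettes read and `J_m(M˙(1)) = 0` (in (3.38)×2 ∕ (3.39) both plaquette sides are `1` for any pure gauge, in (3.42) ∕ `hJn`×2 the currents vanish);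
every pure-gauge unit background is unit-flat (`plaq_gaugeU_one_eq_one`), row P8 is the special case (`unitFlat_of_laws`).  WHY (B).  K1⁷ v6's `stub_nodes13PWS : ∀ F, Inhabited13 F →
NodesAtSomeRecord13PWS F` lets its prover CHOOSE the Stage-13 record; the four-pin engine's N09 row is `h09 : ∀ P, Lemma4Printed (θ.toStage13Params.res.X P).F12 (…).c12` AT THE
PARAMETER.  p607123 shows the zero-letter `λ₁₂⁰` meets that row at `θ.toStage13Params.pinX3H λ₈ λ₁₂⁰ λ₁₃` for every admissible `θ` of the class — and a by-name closure of the crux also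
needs the PINNED parameter to satisfy the crux's THREE antecedent clauses again.  It does, by dag-n10-d's carrier-blind transports (`Record13CarriersCoPH`: `Stage13HParams.pinX3H`,
`pins_toStage13Params` (`rfl`), `pins_admissible_iff`, `pinX3H_guard_iff` (`Iff.rfl`); `Record13CarriersXPinnedHCoPH`: `Provisos₁₃SepCoPH.pinX3H`).  §1–§2 compose the two BY NAME.

WHAT IS PROVED (kernel bookkeeping; theorems only, def-free, sorry-free, standard axioms; nothing re-declared).
* §0 (A) `plaq_gaugeU_one_eq_one`, `unitFlat_of_laws`; `nonempty_b12Package_of_unitFlat_of_zero_letters`, ★ `exists_b12Provisos_of_unitFlat`, ★ `not_failingLemma_of_unitFlat` — p607123 §2 with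
  `Rz.Laws` WEAKENED to unit-flatness (hypotheses `hUn : ∀ j Y m p, plaq ((Rz.bgI j Y).Un m 1) p = 1`, `hJn : ∀ j Y m b, (Rz.bgI j Y).Jn m 1 b = 0`).
* §1 (B) `pinX3H_mem_class`: the three antecedent clauses transport to `θ.pinX3H λ₈ λ₁₂ λ₁₃` for EVERY `λ₈ λ₁₂ λ₁₃` (citation bundle).
* §2 (B) ★★★★ `exists_lam12_pinX3H_mem_class_and_socket09`: for every `θ` of the class, SOME zero-letter `λ₁₂⁰` such that for every `λ₈`, `λ₁₃` the H-pinned parameter is again in the class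
  AND its engine row `h09` holds at every run; ★★★★ `exists_mem_class_socket09_of_antecedent`: K1⁷'s antecedent `∃ θ, Provisos₁₃SepCoPH ∧ (ZhUnity ∧ SlotsNondegenerate₁₃) ∧ Admissible`
  VERBATIM ⇒ `∃ θ'` of the SAME class with `∀ P, Lemma4Printed (θ'.toStage13Params.res.X P).F12 (θ'.toStage13Params.res.X P).c12` — by junk, at any `N`.

WHAT THIS MEANS (located; for plan ∕ dag-lead ∕ K1⁷ stub-1 provers ∕ referees ∕ the def-T ∕ def-B12 desk): (A) whatever normalisation a pin of `bgI` adopts at the unit field, the zero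
letters stay in the horn — the lever on FLAG №7 is the residual LETTERS `λ₁₂.K ∕ λ₁₂.A₂` and the untied `JInputs.Φ₀ ∕ 𝐇`, as said in p607123; (B) a `stub_nodes13PWS` proof that exports
its record at an X-pin with a FREE `λ₁₂` meets `h09` for free — referees should read WHICH `λ₁₂` a closure names (plan (w12)(e): «a hollow closure of conjunct 1 by name would be
FLAGGED, never booked»); the honest `h09` is the one at `λ₁₂ :=` the [15]-chart letters of record (dag-n09-w1 g0's `lemma4Printed_pinB12_of_chart_of_analytic` road, displayed residue
(R1)–(R5) of its HANDOFF), at a pinned `bgI`.  Nothing here bears on `h09T`, on the other twelve rows, or on any count.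

HONEST FRAMING: LOCATED, count-neutral kernel bookkeeping (NODE 00's transports + p607123's pattern, BY NAME); the zero letters are a witness for the BINDERS, NOT print's letters —
NOT Lemma 4 for `U_j(□₀, ·)`; NO estimate of Bałaban's proved or denied; N09 NOT discharged; FLAG №7 neither closed nor widened; K0⁷ ∕ K1⁷ NOT closed (no stub is proved:
`NodesAtSomeRecord13PWS` needs all thirteen rows AND a record); counts unmoved (typed 28∕28 · discharged 5∕27); no summit statement is proved by this seat; conditional finite-𝕋⁴
bookkeeping; R4 closes rung `BalabanLadder.UV` only; NOT ℝ⁴, NOT infinite volume, NOT OS, NOT a mass gap, NOT Clay.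
-/

noncomputable section

namespace Summit.QuantumFields.YangMills.BalabanUVNodes.N09B12ProvisosJunkInClass

open Literature.MathematicalPhysics.QuantumFieldTheory.Balaban1983to89
open Literature.MathematicalPhysics.QuantumFieldTheory.Balaban1983to89.Node00
open Literature.MathematicalPhysics.QuantumFieldTheory.Balaban1983to89.T4Continuum (T4Family)
open Summit.QuantumFields.YangMills.BalabanUVNodes.N09B12ProvisosJunkUnderRzLaws (exists_lam12_socket09_pinX3H_of_provisos₁₃SepCoPH)
open B12RegularSpaces111 (Frame Region StepConsts space space' expI grad CondIV Satisfies plaq gaugeU)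
open B12RegularSpaces111Mono (plaq_one expI_zero unitPair factors_one condI_one condII_zero condIII_one_zero)
open B12RegularSpaces111Gauge (plaq_gaugeU gaugeU_one)
open B12Eq18Current (current)
open B12RegularSpaces111SpecialUnitary (suModel)
open B12Lemma4Models (slProj)
open B12Lemma4ConcreteFrame (JInputs LettersAnalyticAt)
open B12Eq311CurrentExpansion (C311)
open scoped Matrix.Norms.L2Operator

/-! ## §0. (A) ROBUSTNESS — the junk needs only UNIT-FLATNESS of the recipe: `∂(U_m(M˙(1))) = 1`, `J_m(M˙(1)) = 0` (row P8 `Rz.Laws` is the special case `U_m(M˙(1)) = 1`;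
a pin whose unit background is a NON-TRIVIAL PURE GAUGE — e.g. a rooted ∕ axial-gauge selector not normalised at `1` — is covered too, so no re-typing of P8 rescues the «failing lemma») -/

section UnitFlat

variable {P : Params} {N M : ℕ} {Rz : Sect2.Residual P (MatA N)}

/-- `exp iξ·0 = 1` as a configuration. [cite: Balaban1987RG1, (1.13) p.262 (bookkeeping)] -/
private theorem expI_zero_cfg (ξ : ℝ) : (fun b : PBond P 0 => expI ξ ((0 : PBond P 0 → MatA N) b)) = 1 := by
  funext b; rw [Pi.zero_apply, expI_zero]; rfl

/-- `exp iξ(0 + 0) = 1` as a configuration. [cite: Balaban1987RG1, (1.13) p.262 (bookkeeping)] -/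
private theorem expI_zero_add_zero_cfg (ξ : ℝ) :
    (fun b : PBond P 0 => expI ξ ((0 : PBond P 0 → MatA N) b + (0 : PBond P 0 → MatA N) b)) = 1 := by
  funext b; rw [Pi.zero_apply, add_zero, expI_zero]; rfl

/-- A PURE-GAUGE unit background is unit-flat: `∂(1^{w}) = w·1·w⁻¹ = 1` (`plaq_gaugeU`) — so §0's hypothesis covers every recipe sending `1` to a pure gauge.
[cite: Balaban1987RG1, (1.10)–(1.11) p.262 (bookkeeping)] -/
theorem plaq_gaugeU_one_eq_one (w : Site P 0 → (MatA N)ˣ) (p : Plaq P 0) : plaq (gaugeU w (1 : PBond P 0 → (MatA N)ˣ)) p = 1 := by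
  rw [plaq_gaugeU, plaq_one, mul_one, mul_inv_cancel]

/-- Row P8 (`Rz.Laws`) ⇒ unit-flatness (`∂1 = 1`, `plaq_one`) — §0 generalises p607123's hypothesis. [cite: Balaban1987RG1, (1.15) p.262 (bookkeeping)] -/
theorem unitFlat_of_laws (hRz : Rz.Laws) :
    (∀ j Y m p, plaq ((Rz.bgI j Y).Un m (1 : PBond P 0 → (MatA N)ˣ)) p = 1) ∧ ∀ j Y m b, (Rz.bgI j Y).Jn m (1 : PBond P 0 → (MatA N)ˣ) b = 0 :=
  ⟨fun j Y m p => by rw [hRz.bgI_Un_one, plaq_one], hRz.bgI_Jn_one⟩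

variable [NeZero N]

/-- The cost of the unit gauge transformation: `‖1‖·‖1⁻¹‖ ≤ e^{x}` for `0 ≤ x`. [folklore] -/
private theorem cost_one {x : ℝ} (hx : 0 ≤ x) (y : Site P 0) :
    ‖((1 : Site P 0 → (MatA N)ˣ) y : MatA N)‖ * ‖(↑((1 : Site P 0 → (MatA N)ˣ) y)⁻¹ : MatA N)‖ ≤ Real.exp x := by
  simp only [Pi.one_apply, inv_one, Units.val_one, norm_one, mul_one]
  have := Real.add_one_le_exp x
  linarith

omit [NeZero N] in
/-- The unit pair satisfies (i)–(iv) of `U′ᶜ_{k+1}(□₀, ·)` of record over ANY unit-flat recipe (positive radii, `0 < O(1)LMB`): (iv) at `1` reads `‖∂(U_n(M˙(1))) − 1‖ = 0` and `‖J_n(M˙(1))‖ = 0`.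
[cite: Balaban1987RG1, (1.11)–(1.16) p.262, (3.40) p.278] -/
private theorem satisfies_unitPair_frameBox_of_unitFlat
    (hUn : ∀ j Y m p, plaq ((Rz.bgI j Y).Un m (1 : PBond P 0 → (MatA N)ˣ)) p = 1) (hJn : ∀ j Y m b, (Rz.bgI j Y).Jn m (1 : PBond P 0 → (MatA N)ˣ) b = 0)
    (𝓜 : B12RegularSpaces111.Model (MatA N)) (lam : ResidB12Run P N M)
    {cB : ℝ} (hcB : 0 < cB) {α₀ α₁ γ₀ : ℝ} (hα₀ : 0 < α₀) (hα₁ : 0 < α₁) (hγ₀ : 0 < γ₀) :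
    Satisfies 𝓜 (lam.frameBox Rz) (lam.csBox cB) α₀ α₁ γ₀ unitPair := by
  have hξ' : 0 < (lam.csBox cB).ξ := pow_pos (inv_pos.mpr (Nat.cast_pos.mpr P.L_pos)) _
  have hξ : (lam.csBox cB).ξ ≠ 0 := hξ'.ne'
  have hL : 0 < (lam.csBox cB).L := Nat.cast_pos.mpr P.L_pos
  have hIV : CondIV (lam.frameBox Rz).bg (lam.frameBox Rz).X₂ (lam.csBox cB) α₀ (unitPair (P := P) (i := 0) (𝔸 := MatA N)).U := by
    refine ⟨fun n _ _ p _ => ?_, fun n _ _ b _ => ?_⟩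
    · rw [show (lam.frameBox Rz).bg.Un n (unitPair (P := P) (i := 0) (𝔸 := MatA N)).U = (Rz.bgI _ _).Un n 1 from rfl, hUn, Units.val_one, sub_self, norm_zero]
      positivity
    · rw [show (lam.frameBox Rz).bg.Jn n (unitPair (P := P) (i := 0) (𝔸 := MatA N)).U b = (Rz.bgI _ _).Jn n 1 b from rfl, hJn, norm_zero]
      positivity
  exact ⟨fun _ _ => 𝓜.Gc.one_mem, fun _ _ => 𝓜.gc.zero_mem, 1, fun _ => 0, factors_one _, condI_one (𝓜 := 𝓜) _ hξ hcB hα₀,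
    condII_zero (𝓜 := 𝓜) _ _ hα₁ 1, condIII_one_zero _ hξ hα₀ hγ₀, hIV, hIV⟩

/-- The zero-letter `JInputs` over ANY unit-flat recipe (p607123's instance with the two `U_m(M˙(1)) = 1` faces weakened to `∂(U_m(M˙(1))) = 1`: in (3.38)×2 ∕ (3.39) both plaquette sides are `1`
whatever the pure gauge, in (3.42) ∕ `hJn`×2 the currents vanish).  A witness for the BINDER; NOT print's letters. [cite: Balaban1987RG1, (3.37)–(3.52) pp.277–280 (bookkeeping: the junk instance)] -/
private theorem nonempty_jInputs_zero_of_unitFlat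
    (hUn : ∀ j Y m p, plaq ((Rz.bgI j Y).Un m (1 : PBond P 0 → (MatA N)ˣ)) p = 1) (hJn : ∀ j Y m b, (Rz.bgI j Y).Jn m (1 : PBond P 0 → (MatA N)ˣ) b = 0)
    (lam : ResidB12Run P N M) {cB : ℝ} (hcB : 0 < cB)
    (hB₃ : 0 < lam.consts.B₃) (hO₁ : 0 < lam.consts.O₁) (hM : 0 < lam.consts.M) (hβ : 0 < lam.consts.β) (hα₀ : 0 < lam.consts.α₀) (hα₁ : 0 < lam.consts.α₁)
    (hB'' : 0 ≤ lam.B₃'') (τ : ℝ) {n : ℝ} (hn : 0 ≤ n) :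
    Nonempty (JInputs (suModel N) lam.consts (lam.frameX Rz) (lam.frameBox Rz) (lam.csX cB) (lam.csBox cB) lam.regionY (slProj N) lam.idx.η lam.B₃'' lam.α₀
      lam.idx.j τ n (0 : PBond P 0 → MatA N) (0 : PBond P 0 → MatA N)) := by
  have hL : 0 < lam.consts.L := Nat.cast_pos.mpr P.L_pos
  have hη : 0 < lam.idx.η := pow_pos (inv_pos.mpr (Nat.cast_pos.mpr P.L_pos)) _
  have hx : 0 < lam.consts.L ^ (lam.idx.j - 1) * lam.idx.η := by positivity
  have hS1 : 0 < lam.consts.B₃ ^ 2 * lam.consts.O₁ * lam.consts.M * lam.consts.α₀ * (lam.consts.L ^ (lam.idx.j - 1) * lam.idx.η) := by positivity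
  have hS2 : 0 < lam.consts.B₃ * (lam.consts.B₃ * lam.consts.O₁ * lam.consts.M * lam.consts.α₀ * (lam.consts.L ^ (lam.idx.j - 1) * lam.idx.η)) ^ 2 := by positivity
  have hS3 : 0 < lam.consts.β * lam.consts.α₀ * (lam.consts.L ^ (lam.idx.j - 1) * lam.idx.η) ^ 2 := by positivity
  have hα₀' : 0 < lam.α₀ := hα₀
  have h2β : 0 < 1 + 2 * lam.consts.β := by positivity
  -- the four frame-level faces at the unit configuration (both frames read `Rz.bgI` at their level ∕ domain)
  have hUnX : ∀ m p, plaq ((lam.frameX Rz).bg.Un m (1 : PBond P 0 → (MatA N)ˣ)) p = 1 := fun m p => hUn _ _ m p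
  have hJnX : ∀ m b, (lam.frameX Rz).bg.Jn m (1 : PBond P 0 → (MatA N)ˣ) b = 0 := fun m b => hJn _ _ m b
  have hUnB : ∀ m p, plaq ((lam.frameBox Rz).bg.Un m (unitPair (P := P) (i := 0) (𝔸 := MatA N)).U) p = 1 := fun m p => hUn _ _ m p
  have hJnB : ∀ m b, (lam.frameBox Rz).bg.Jn m (unitPair (P := P) (i := 0) (𝔸 := MatA N)).U b = 0 := fun m b => hJn _ _ m b
  refine ⟨
    { Φ₀ := unitPair
      hΦ₀ := satisfies_unitPair_frameBox_of_unitFlat hUn hJn (suModel N) lam hcB (mul_pos h2β hα₀) (mul_pos h2β hα₁) hα₀'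
      H := 0, H₁ := 0, ℓ := 0, uj := 1, ubar1 := 1, vj := 1, v := 1, ubar := fun _ => 1, w₁ := fun _ => 1
      ctr := fun _ x => x
      hKgc := fun _ => (suModel N).gc.zero_mem
      hAgc := fun _ => (suModel N).gc.zero_mem
      huj := cost_one (by positivity)
      hubar1 := cost_one (by positivity)
      hvj := cost_one (by positivity)
      hv := cost_one (by positivity)
      hubar := fun _ _ => rfl
      h339 := fun p _ => by
        rw [expI_zero_cfg, plaq_gaugeU, hUnB, plaq_one, mul_one, mul_inv_cancel]
      h342 := fun b _ => by
        rw [expI_zero_cfg, B12Eq44Space.current_one, hJnB, smul_zero, mul_zero, zero_mul]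
      h338 := fun m _ _ p _ => by
        rw [expI_zero_add_zero_cfg, plaq_gaugeU, hUnX, plaq_one, mul_one, mul_inv_cancel]
      hJn := fun m _ _ b _ => by
        rw [expI_zero_add_zero_cfg, hJnX, inv_one, mul_one, gaugeU_one, B12Eq44Space.current_one]
      h338₁ := fun m _ _ p _ => by
        rw [hUnX, gaugeU_one, plaq_one]
      hJn₁ := fun m _ _ b _ => by
        rw [hJnX, gaugeU_one, B12Eq44Space.current_one]
      hH := fun b => by rw [Pi.zero_apply, norm_zero]; exact hS1
      hHd := fun μ ν y => by
        simp only [grad, Pi.zero_apply, sub_self, smul_zero, norm_zero]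
        exact hS1
      h45 := fun p _ => by
        simp only [Pi.zero_apply, add_zero, sub_self, smul_zero, norm_zero]
        exact hS2
      hK := fun b => by rw [Pi.zero_apply, norm_zero]; exact hS1
      hKd := fun μ ν y => by
        simp only [grad, Pi.zero_apply, sub_self, smul_zero, norm_zero]
        exact hS1
      h45τ := fun p _ => by
        simp only [Pi.zero_apply, add_zero, sub_self, smul_zero, norm_zero]
        exact hS2
      hA := fun b => by rw [Pi.zero_apply, norm_zero]; positivity
      hAd := fun μ ν y => by
        simp only [grad, Pi.zero_apply, sub_self, smul_zero, norm_zero]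
        positivity
      hS := fun b _ => by
        rw [sub_zero, B12CondIIIJConcreteModels.lapCur_zero, norm_zero]
        exact hS3
      hSτ := fun b _ => by
        rw [smul_zero, sub_zero, B12CondIIIJConcreteModels.lapCur_zero, norm_zero]
        exact hS3
      hA2 := fun b _ => by
        rw [B12CondIIIJConcreteModels.lapCur_zero, norm_zero]
        positivity }⟩

/-- **(A) THE PACKAGE IS INHABITED BY THE JUNK LETTERS OVER ANY UNIT-FLAT RECIPE** (hypotheses as in p607123's `nonempty_b12Package_of_laws_of_zero_letters`, with `Rz.Laws` weakened to
`∂(U_m(M˙(1))) = 1`, `J_m(M˙(1)) = 0`).  A witness for the BINDERS; NOT print's letters; NOT a discharge of anything.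
[cite: Balaban1987RG1, Lemma 4 (3.53) p.280 with (3.26)–(3.52) pp.275–280 (bookkeeping: the junk instance)] -/
theorem nonempty_b12Package_of_unitFlat_of_zero_letters
    (hUn : ∀ j Y m p, plaq ((Rz.bgI j Y).Un m (1 : PBond P 0 → (MatA N)ˣ)) p = 1) (hJn : ∀ j Y m b, (Rz.bgI j Y).Jn m (1 : PBond P 0 → (MatA N)ˣ) b = 0)
    {cB : ℝ} (hcB : 0 < cB) (lam : ResidB12Run P N M)
    (hX3 : lam.idx.XSites ⊆ lam.idx.boxT 3)
    (hK : ∀ Φ A τ, lam.K Φ A τ = 0) (hA₂ : ∀ Φ A τ B', lam.A₂ Φ A τ B' = 0)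
    (hR : B12Sec2to5.Lemma4Restrictions lam.consts)
    (hB : 1 ≤ lam.consts.B₃) (hY : 1 ≤ lam.consts.B₃ ^ 2 * lam.consts.O₁ * lam.consts.M)
    (hα₁ : 16 * (lam.consts.O₁ * lam.consts.M * lam.consts.α₁) ≤ lam.consts.β) (hL10 : 1 + 10 * lam.consts.β ≤ lam.consts.L ^ 2)
    (hB'' : 0 ≤ lam.B₃'') (hres'' : lam.B₃'' * lam.consts.α₃ ≤ lam.consts.β * lam.consts.L⁻¹ ^ 2 * lam.consts.α₀)
    (hresJ : 4 * ((P.d - 1) * ((2 : ℝ) * C311 1)) * (lam.consts.B₃ ^ 2 * lam.consts.O₁ * lam.consts.M) ^ 2 * lam.consts.α₀ ≤ lam.consts.β) :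
    Nonempty (B12Package Rz cB lam) := by
  obtain ⟨hα₀, hα₁', -, -, hβ, -⟩ := hR
  have hB₃ : 0 < lam.consts.B₃ := one_pos.trans_le hB
  have hMnn : 0 ≤ lam.consts.M := Nat.cast_nonneg M
  have hOM : 0 < lam.consts.O₁ * lam.consts.M := by
    by_contra hle
    rw [not_lt] at hle
    have : lam.consts.B₃ ^ 2 * lam.consts.O₁ * lam.consts.M ≤ 0 := by
      rw [mul_assoc]; exact mul_nonpos_of_nonneg_of_nonpos (sq_nonneg _) hle
    linarith
  have hMpos : 0 < lam.consts.M := by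
    rcases hMnn.eq_or_lt with hM0 | hM0
    · rw [← hM0, mul_zero] at hOM; exact absurd hOM (lt_irrefl 0)
    · exact hM0
  have hO₁ : 0 < lam.consts.O₁ := by
    by_contra hle
    rw [not_lt] at hle
    have : lam.consts.O₁ * lam.consts.M ≤ 0 := mul_nonpos_iff.mpr (Or.inr ⟨hle, hMpos.le⟩)
    linarith
  refine ⟨
    { hB := hB, hY := hY, hα₁ := hα₁, hL10 := hL10, hB'' := hB'', hres'' := hres'', hresJ := hresJ
      hXb := lam.frameX_X_bonds_subset_regionY Rz hX3
      hXd := lam.frameX_X_dpairs_subset_regionY Rz hX3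
      hX₂b := lam.frameX_X₂_bonds_subset_regionY Rz hX3
      hX₂p := lam.frameX_X₂_plaqs_subset_X Rz
      hXp' := lam.frameX_X_plaqs_subset_frameBox_X₂ Rz hX3
      hYb' := lam.regionY_bonds_subset_frameBox_X₂ Rz
      hXp := lam.stencil_subset_regionY Rz hX3
      inputs := fun Φ A τ B' _ _ _ _ _ => by
        rw [hK, hA₂]
        exact Classical.choice (nonempty_jInputs_zero_of_unitFlat hUn hJn lam hcB hB₃ hO₁ hMpos hβ hα₀ hα₁' hB'' τ (norm_nonneg B'))
      hKan := fun τ _ _ _ _ _ _ b => by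
        simp only [hK, Pi.zero_apply]
        exact analyticAt_const
      hA2an := fun τ _ _ _ _ _ _ b => by
        simp only [hA₂, Pi.zero_apply]
        exact analyticAt_const }⟩

/-- **★ (A) THE HONEST HORN `B12Provisos` IS INHABITED BY ZERO LETTERS OVER EVERY UNIT-FLAT RECIPE** (`M ≥ 1`, `0 < O(1)LMB`) — in particular over every recipe whose unit backgrounds are pure
gauges (`plaq_gaugeU_one_eq_one`), whatever normalisation a future pin of `bgI` adopts.  JUNK witness for the binders. [cite: Balaban1987RG1, Lemma 4 p.280, §3 pp.276–280 (bookkeeping)] -/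
theorem exists_b12Provisos_of_unitFlat
    (hUn : ∀ j Y m p, plaq ((Rz.bgI j Y).Un m (1 : PBond P 0 → (MatA N)ˣ)) p = 1) (hJn : ∀ j Y m b, (Rz.bgI j Y).Jn m (1 : PBond P 0 → (MatA N)ˣ) b = 0)
    (hM : 1 ≤ M) {cB : ℝ} (hcB : 0 < cB) :
    ∃ lam : ResidB12Run P N M, lam.idx.XSites ⊆ lam.idx.boxT 2 ∧ (∀ Φ A τ, lam.K Φ A τ = 0) ∧ (∀ Φ A τ B', lam.A₂ Φ A τ B' = 0) ∧
      B12Provisos Rz cB lam := by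
  obtain ⟨lam, hX, h0, hR, hB, hY, hα₁, hL10, hB'', hres'', hresJ⟩ := exists_residB12Run_restrictions P N M hM P.hL.2
  refine ⟨{ lam with K := fun _ _ _ _ => 0, A₂ := fun _ _ _ _ _ => 0 }, hX, fun _ _ _ => rfl, fun _ _ _ _ => rfl, ⟨?_, hR, h0⟩⟩
  exact nonempty_b12Package_of_unitFlat_of_zero_letters hUn hJn hcB _ (IdxB12.XSites_subset_boxT_three_of_two _ hX) (fun _ _ _ => rfl) (fun _ _ _ _ => rfl)
    hR hB hY hα₁ hL10 hB'' hres'' hresJ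

/-- **★ (A) THE «FAILING LEMMA» IS FALSE AT EVERY UNIT-FLAT RECIPE** — not only at the P8-abiding ones (p607123 `not_failingLemma_of_laws`): no re-typing of row P8 to «pure gauge at `1`»
rescues №209's deliverable as specified.  LOCATED; count-neutral. [cite: Balaban1987RG1, Lemma 4 p.280, (1.15)–(1.16) p.262 (bookkeeping)] -/
theorem not_failingLemma_of_unitFlat
    (hUn : ∀ j Y m p, plaq ((Rz.bgI j Y).Un m (1 : PBond P 0 → (MatA N)ˣ)) p = 1) (hJn : ∀ j Y m b, (Rz.bgI j Y).Jn m (1 : PBond P 0 → (MatA N)ˣ) b = 0)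
    (hM : 1 ≤ M) {cB : ℝ} (hcB : 0 < cB) :
    ¬ ∀ lam : ResidB12Run P N M, (∀ Φ A τ, lam.K Φ A τ = 0) → (∀ Φ A τ B', lam.A₂ Φ A τ B' = 0) → ¬ B12Provisos Rz cB lam := by
  intro h
  obtain ⟨lam, -, hK, hA₂, hP⟩ := exists_b12Provisos_of_unitFlat (N := N) hUn hJn hM hcB
  exact h lam hK hA₂ hP

end UnitFlat

variable {F : T4Family} {N : ℕ} [NeZero N]

/-! ## §1. (B) The three antecedent clauses of K1⁷ transport to the H-level X-pin (citation bundle over dag-n10-d's carrier-blind faces) -/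

/-- **K1⁷'s ANTECEDENT CLASS IS CLOSED UNDER THE H-LEVEL X-PIN**: `Provisos₁₃SepCoPH` (`Provisos₁₃SepCoPH.pinX3H`), the guard `ZhUnity ∧ SlotsNondegenerate₁₃` (`pinX3H_guard_iff`, `Iff.rfl`) and
`Admissible` (`pins_admissible_iff`) all hold at `θ.pinX3H λ₈ λ₁₂ λ₁₃` as soon as they hold at `θ` — for EVERY choice of the three residual layers, junk or not.
[cite: Balaban1988Convergent, (2.18) p.257, (3.16)–(3.22) pp.268–269 (the class; bookkeeping)] -/
theorem pinX3H_mem_class {θ : Stage13HParams F N} (h : θ.Provisos₁₃SepCoPH F N) (hg : θ.ZhUnity F N ∧ θ.SlotsNondegenerate₁₃ F N) (hθ : θ.Admissible F N)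
    (lam8 : ResidB8 θ.toStage3Params) (lam12 : ResidB12 F N θ.τ9.M) (lam13 : B12.RunParams → ResidB13 θ.toStage3Params) :
    (θ.pinX3H F N lam8 lam12 lam13).Provisos₁₃SepCoPH F N ∧
      ((θ.pinX3H F N lam8 lam12 lam13).ZhUnity F N ∧ (θ.pinX3H F N lam8 lam12 lam13).SlotsNondegenerate₁₃ F N) ∧
        (θ.pinX3H F N lam8 lam12 lam13).Admissible F N :=
  ⟨h.pinX3H lam8 lam12 lam13, (Stage13HParams.pinX3H_guard_iff F N θ lam8 lam12 lam13).2 hg,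
    (Stage13Params.pinX3H_admissible_iff F N θ.toStage13Params lam8 lam12 lam13).2 hθ⟩

/-! ## §2. (B) Inside the class: a zero-letter X-pin at which the engine's `h09` row holds -/

/-- **★★★★ FOR EVERY PARAMETER OF K1⁷'s ANTECEDENT CLASS, A ZERO-LETTER X-PIN STAYS IN THE CLASS AND MEETS THE ENGINE'S N09 ROW**: there is a residual [B12] layer `λ₁₂⁰` with `𝐊 = 𝐀₂ = 0`
such that for EVERY `λ₈`, `λ₁₃` the H-pinned parameter `θ' := θ.pinX3H λ₈ λ₁₂⁰ λ₁₃` again satisfies `Provisos₁₃SepCoPH ∧ (ZhUnity ∧ SlotsNondegenerate₁₃) ∧ Admissible` AND dag-n12-d's engine row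
`h09 : ∀ P, Lemma4Printed (θ'.toStage13Params.res.X P).F12 (θ'.toStage13Params.res.X P).c12` holds (p607123 `exists_lam12_socket09_pinX3H_of_provisos₁₃SepCoPH`; `(θ.pinX3H …).toStage13Params =
θ.toStage13Params.pinX3H …` by `rfl`).  LOCATED hollow-closure certificate — NOT Lemma 4 for print's letters; N09 NOT discharged; K1⁷ NOT closed; count-neutral.
[cite: Balaban1987RG1, Lemma 4 (3.53) p.280; Balaban1988Convergent, (2.18) p.257 (bookkeeping)] -/
theorem exists_lam12_pinX3H_mem_class_and_socket09 {θ : Stage13HParams F N} (h : θ.Provisos₁₃SepCoPH F N) (hg : θ.ZhUnity F N ∧ θ.SlotsNondegenerate₁₃ F N)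
    (hθ : θ.Admissible F N) :
    ∃ lam12 : ResidB12 F N θ.τ9.M, (∀ P : B12.RunParams, (∀ Φ A τ, (lam12 P).K Φ A τ = 0) ∧ (∀ Φ A τ B', (lam12 P).A₂ Φ A τ B' = 0)) ∧
      ∀ (lam8 : ResidB8 θ.toStage3Params) (lam13 : B12.RunParams → ResidB13 θ.toStage3Params),
        ((θ.pinX3H F N lam8 lam12 lam13).Provisos₁₃SepCoPH F N ∧
          ((θ.pinX3H F N lam8 lam12 lam13).ZhUnity F N ∧ (θ.pinX3H F N lam8 lam12 lam13).SlotsNondegenerate₁₃ F N) ∧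
            (θ.pinX3H F N lam8 lam12 lam13).Admissible F N) ∧
        ∀ P : B12.RunParams, B12Sec2to5.Lemma4Printed ((θ.pinX3H F N lam8 lam12 lam13).toStage13Params.res.X P).F12
          ((θ.pinX3H F N lam8 lam12 lam13).toStage13Params.res.X P).c12 := by
  obtain ⟨lam12, hz, hsock⟩ := exists_lam12_socket09_pinX3H_of_provisos₁₃SepCoPH h hθ
  exact ⟨lam12, hz, fun lam8 lam13 => ⟨pinX3H_mem_class h hg hθ lam8 lam12 lam13, fun P => hsock lam8 lam13 P⟩⟩

/-- **★★★★ K1⁷'s ANTECEDENT, VERBATIM, YIELDS A PARAMETER OF THE SAME CLASS AT WHICH THE ENGINE'S N09 ROW HOLDS BY JUNK** (any `N`; the crux has `N = 2`): from `∃ θ, θ.Provisos₁₃SepCoPH ∧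
(θ.ZhUnity ∧ θ.SlotsNondegenerate₁₃) ∧ θ.Admissible` one gets `θ'` with the same three clauses and `∀ P, Lemma4Printed (θ'.toStage13Params.res.X P).F12 (θ'.toStage13Params.res.X P).c12`
(`θ' :=` the zero-letter X-pin of §2 at node00-def's degenerate layers `nonempty_residB8` ∕ `nonempty_residB13` — any layers do).  LOCATED: inside the crux's quantifier structure the `h09` row
carries no content unless the closure NAMES print's `λ₁₂`; count-neutral; K1⁷ NOT closed (no record, no other row is produced here).
[cite: Balaban1987RG1, Lemma 4 (3.53) p.280; Balaban1988Convergent, (2.18) p.257 (bookkeeping)] -/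
theorem exists_mem_class_socket09_of_antecedent
    (hex : ∃ θ : Stage13HParams F N, θ.Provisos₁₃SepCoPH F N ∧ (θ.ZhUnity F N ∧ θ.SlotsNondegenerate₁₃ F N) ∧ θ.Admissible F N) :
    ∃ θ' : Stage13HParams F N, (θ'.Provisos₁₃SepCoPH F N ∧ (θ'.ZhUnity F N ∧ θ'.SlotsNondegenerate₁₃ F N) ∧ θ'.Admissible F N) ∧
      ∀ P : B12.RunParams, B12Sec2to5.Lemma4Printed (θ'.toStage13Params.res.X P).F12 (θ'.toStage13Params.res.X P).c12 := by
  obtain ⟨θ, h, hg, hθ⟩ := hex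
  obtain ⟨lam12, -, hpin⟩ := exists_lam12_pinX3H_mem_class_and_socket09 h hg hθ
  obtain ⟨lam8⟩ := nonempty_residB8 (θ := θ.toStage3Params)
  obtain ⟨lam13⟩ := nonempty_residB13 θ.toStage3Params
  exact ⟨θ.pinX3H F N lam8 lam12 (fun _ => lam13), (hpin lam8 fun _ => lam13).1, (hpin lam8 fun _ => lam13).2⟩

end Summit.QuantumFields.YangMills.BalabanUVNodes.N09B12ProvisosJunkInClass

end
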